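import Summits.FinalStateConjecture.FinalStateConjecture.Theorems.BartnikGapSettlingBondiBartnikRigiditySlabCauchyRigiditySecondFormChart
import HarnessLib

/-!
# F1' `stub_slabCauchyRigidity'`, step (b) at order `1`: the second fundamental form identity on the
# open slab (`Φ_N^* k = K_{ν_N}(ψ_N)`) — line `direct-method-on-the-cone`, crux `BondiBartnikRigidity`
# (stmt-FinalStateConjecture-10807); module 9 of the landing of the conditional proof of F1'

The order-`1` half (A2k) of the second input of route statement (A) `F1Route.SlabSubdatum`
(`…SlabCauchyRigidityDefs.lean`), PROVED with its statement written out (no new `Prop` definition):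

* `slabSecondFormIdentity_holds` — for a future-oriented exact collar chart `Φ₀` (exact `k'`-jet on
  the thick slab, `k' ≥ 1`) of a vacuum development and ANY smooth `Φ_N` through which it factors on
  the open slab, `Φ_N^* k = K_{ν_N}(ψ_N)`, the Kerr slab second fundamental form.  Both sides equal the
  same metric-free expression in the `1`-jet of the background components at the slab point: the
  development side by `collar_secondFundamentalForm_chart` (`…SecondFormChart.lean`), once the Kerr
  normal representative `N = (1 + 2H)^{-1/2} V`, transported by `Λ`, is shown to be pushed by `dΦ₀`
  to the future unit normal `ν ∘ Φ_N` — this is where the orientation hypothesis (H8) enters, through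
  `TimeOrientation.eq_of_isFutureUnitNormal` — and the Kerr side by
  `kerrSlab_secondFundamentalForm_chart` (`…SecondFormKerr.lean`).

Registered bookkeeping sub-goal of the line: `stub_slabSecondFormIdentity`.

References: O'Neill 1983, Ch. 4, Lemma 4.1 and Cor. 4.5 [ONeill1983]; Cook 2000, §3.2.2.  No
definitions, no named facts.
-/

noncomputable section

-- D-0017: single-problem summit, `Summit.<S>.<S>.…` by design (cf. lakefile `weak.linter.dupNamespace`).
set_option linter.dupNamespace false
set_option maxSynthPendingDepth 3

open Set Filter Function Topology TopologicalSpace Bundle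
open Literature.Geometry.Lorentzian
open scoped Manifold ContDiff Topology ENNReal

namespace Summit.FinalStateConjecture.FinalStateConjecture.Theorems.BondiBartnikRigidity.DirectMethod

namespace F1Route

/-- `Λ⁻¹((Λ z + c) − c) = z` (local copy of `poincareInv_lab` of the factorisation module, which is
landed in parallel). [folklore] -/
private theorem poincareInv_lab₂ (mo : lorentzGroup × E4) (z : E4) :
    poincareInv mo.1 mo.2 ((mo.1 : E4 ≃L[ℝ] E4) z + mo.2) = z := by
  simp [poincareInv]

set_option synthInstance.maxHeartbeats 200000 in
/-- Exactness at order `0` on the slab: the deviation vanishes at slab points (local copy of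
`deviation_eq_zero_of_truncDeviationCk_le_zero` of the factorisation module). [folklore] -/
private theorem deviation_eq_zero_of_truncDeviationCk_le_zero₂ {𝒮 : Spacetime.{0} 4}
    {B : ModelBackground} {Φ₀ : B.domain → 𝒮.carrier} {k : ℕ} {R τ : ℝ}
    (h : 𝒮.truncDeviationCk B Φ₀ k R τ ≤ 0) {x : B.domain} (hx : x ∈ B.truncTimeSlab R τ) :
    𝒮.deviation B Φ₀ x = 0 := by
  have hle := (enorm_iteratedFDeriv_le_supCkENorm (k := k) (m := 0) (Nat.zero_le _)
    (mem_image_of_mem Subtype.val hx) (𝒮.deviationExtend B Φ₀)).trans h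
  have h0 : iteratedFDeriv ℝ 0 (𝒮.deviationExtend B Φ₀) x.1 = 0 := by
    have := le_antisymm hle zero_le
    rwa [enorm_eq_zero] at this
  have h1 := congrArg (fun F => F Fin.elim0) h0
  simp only [iteratedFDeriv_zero_apply, Spacetime.deviationExtend_coe] at h1
  exact h1

set_option synthInstance.maxHeartbeats 400000 in
set_option maxHeartbeats 1600000 in
/-- **(A2k) `slabSecondFormIdentity_holds`** — the second fundamental form identity: for a
future-oriented exact collar chart (exact `k'`-jet on the thick slab, `k' ≥ 1`) of a vacuum
development and any smooth `Φ_N` through which it factors on the open slab,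
`Φ_N^* k = K_{ν_N}(ψ_N)`. [cite: ONeill1983, Ch. 4, Cor. 4.5] -/
theorem slabSecondFormIdentity_holds :
    ∀ [Kerr.Facts] [Kerr.SliceFacts] (k' : ℕ), 1 ≤ k' →
    ∀ (X : Type) [TopologicalSpace X] [ChartedSpace E3 X] [IsManifold (𝓡 3) ∞ X]
      [T2Space X] [SecondCountableTopology X] [ConnectedSpace X]
      (D : InitialDataSet (𝓡 3) X) (𝒱 : VacuumCauchyDevelopment D)
      (M a : ℝ) (mo : lorentzGroup × E4) (B : ModelBackground) (Φ₀ : B.domain → 𝒱.carrier)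
      (ΦN : slabW M a → X), 0 < M → |a| < M →
    B = starBackground mo.1 mo.2 M a (fun x => Kerr.radius a (poincareInv mo.1 mo.2 x)) →
    (ContMDiffOn 𝓘(ℝ, E4) (𝓡 4) ∞ Φ₀
        {x | -1 < B.time x.1 ∧ B.time x.1 < 1 ∧ B.radius x.1 < 3 * M + 1} ∧
      IsOpenEmbedding ({x | -1 < B.time x.1 ∧ B.time x.1 < 1 ∧
        B.radius x.1 < 3 * M + 1}.restrict Φ₀)) →
    𝒱.toSpacetime.truncDeviationCk B Φ₀ k' (3 * M) 0 ≤ 0 →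
    Φ₀ '' B.truncTimeSlab (3 * M) 0 ⊆ range 𝒱.embed →
    (∀ x ∈ B.truncTimeSlab (3 * M) 0, 𝒱.timeOrientation.IsFutureDirected
      (mfderiv 𝓘(ℝ, E4) (𝓡 4) Φ₀ x
        ((mo.1 : E4 ≃L[ℝ] E4) (Kerr.timeVector M a (poincareInv mo.1 mo.2 x.1))))) →
    ContMDiff (𝓡 3) (𝓡 3) ((((⊤ : ℕ∞) : WithTop ℕ∞)) + 1) ΦN →
    (∀ y : slabW M a, ∃ hx : ((mo.1 : E4 ≃L[ℝ] E4) (E4.ofTimeSpace 0 (y : E3)) + mo.2) ∈ B.domain,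
        𝒱.embed (ΦN y) = Φ₀ ⟨_, hx⟩) →
    ∀ [(Kerr.smoothMetric M a M).HasLeviCivita] (y : slabW M a) (v w : E3),
      D.k (ΦN y) (mfderiv (𝓡 3) (𝓡 3) ΦN y v) (mfderiv (𝓡 3) (𝓡 3) ΦN y w) =
        (Kerr.smoothMetric M a M).secondFundamentalForm 𝓘(ℝ, E3) (ψN M a) (νN M a) y v w := by
  intro _ _ k' hk' X _ _ _ _ _ _ D 𝒱 M a mo B Φ₀ ΦN hM ha hB hΦ hdev hslab hor hΦNs hιΦ _ y v w
  haveI hLC : 𝒱.metric.toPseudoRiemannianMetric.HasLeviCivita :=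
    𝒱.metric.toPseudoRiemannianMetric.hasLeviCivita
  /- ## notation and elementary facts (as in the metric identity) -/
  set P : E4 → E4 := poincareInv mo.1 mo.2 with hP
  set Λ : E4 ≃L[ℝ] E4 := (mo.1 : E4 ≃L[ℝ] E4) with hΛ
  have hdom : (B.domain : Set E4) = P ⁻¹' (Kerr.region a M : Set E4) := by rw [hB]; rfl
  have htime : B.time = fun x => P x 0 := by rw [hB]; rfl
  have hrad : B.radius = fun x => Kerr.radius a (P x) := by rw [hB]; rfl
  have hbil : B.bilin = boostedKerrBilin mo.1 mo.2 M a := by rw [hB]; rfl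
  have hPreg : ∀ x : B.domain, P x.1 ∈ Kerr.region a M := fun x => by
    have hx : (x.1 : E4) ∈ (B.domain : Set E4) := x.2
    rw [hdom] at hx
    exact hx
  set A : E3 → E4 := fun z => Λ (E4.ofTimeSpace 0 z) + mo.2 with hA
  have hPA : ∀ z, P (A z) = E4.ofTimeSpace 0 z := fun z => poincareInv_lab₂ mo _
  have hAd : ∀ z, HasFDerivAt A ((Λ : E4 →L[ℝ] E4).comp E4.spaceEmbed) z :=
    fun z => ((Λ : E4 →L[ℝ] E4).hasFDerivAt.comp z (E4.hasFDerivAt_ofTimeSpace 0 z)).add_const mo.2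
  have hAs : ContDiff ℝ ∞ A :=
    ((Λ : E4 →L[ℝ] E4).contDiff.comp (E4.contDiff_ofTimeSpace 0)).add contDiff_const
  have hmem : ∀ y : slabW M a, A (y : E3) ∈ B.domain := fun y => (hιΦ y).1
  set eN : slabW M a → B.domain := fun y => ⟨A (y : E3), hmem y⟩ with heN
  have hcomp : ∀ y, 𝒱.embed (ΦN y) = Φ₀ (eN y) := fun y => (hιΦ y).2
  have heNs : ContMDiff 𝓘(ℝ, E3) 𝓘(ℝ, E4) ∞ eN := by
    rw [← ContMDiff.subtypeVal_comp_iff]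
    exact (hAs.contMDiff.comp contMDiff_subtype_val).comp contMDiff_subtype_val
  have hdeN : ∀ y : slabW M a, mfderiv 𝓘(ℝ, E3) 𝓘(ℝ, E4) eN y =
      ((Λ : E4 →L[ℝ] E4).comp E4.spaceEmbed) := by
    intro y
    have hdAz : MDifferentiableAt 𝓘(ℝ, E3) 𝓘(ℝ, E4) (fun z : Kerr.slice a M => A z.1) y.1 :=
      ((hAs.contMDiff.comp contMDiff_subtype_val) y.1).mdifferentiableAt (by simp)
    have hd1 : MDifferentiableAt 𝓘(ℝ, E3) 𝓘(ℝ, E4) (fun y : slabW M a => A (y : E3)) y :=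
      (((hAs.contMDiff.comp contMDiff_subtype_val).comp contMDiff_subtype_val) y).mdifferentiableAt
        (by simp)
    rw [OpensChart.mfderiv_codRestrict (U' := B.domain) (φ := eN) (f := fun y : slabW M a => A (y : E3))
        (fun _ => rfl) hd1,
      show (fun y : slabW M a => A (y : E3)) = (fun z : Kerr.slice a M => A z.1) ∘ Subtype.val from rfl,
      mfderiv_comp_subtypeVal hdAz,
      show (fun z : Kerr.slice a M => A z.1) = A ∘ Subtype.val from rfl,
      mfderiv_comp_subtypeVal (hAs.contMDiff.contMDiffAt.mdifferentiableAt (by simp)),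
      mfderiv_eq_fderiv, (hAd _).fderiv]
  have hslabmem : ∀ y : slabW M a, eN y ∈ B.truncTimeSlab (3 * M) 0 := fun y => by
    refine ⟨?_, ?_⟩
    · rw [htime]; show P (A _) 0 = 0; rw [hPA]; rfl
    · rw [hrad]; show Kerr.radius a (P (A _)) ≤ 3 * M; rw [hPA]; exact y.2.le
  have hlayer : ∀ y : slabW M a, eN y ∈
      {x : B.domain | -1 < B.time x.1 ∧ B.time x.1 < 1 ∧ B.radius x.1 < 3 * M + 1} := fun y => by
    obtain ⟨h0, hr⟩ := hslabmem y
    exact ⟨by rw [h0]; norm_num, by rw [h0]; norm_num, by linarith⟩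
  have hLo : IsOpen {x : B.domain | -1 < B.time x.1 ∧ B.time x.1 < 1 ∧ B.radius x.1 < 3 * M + 1} := by
    have ht : Continuous fun x : B.domain => B.time x.1 := by
      rw [htime]
      exact ((PiLp.continuous_apply 2 _ 0).comp (continuous_poincareInv _ _)).comp continuous_subtype_val
    have hr : Continuous fun x : B.domain => B.radius x.1 := by
      rw [hrad]
      exact ((Kerr.continuous_radius a).comp (continuous_poincareInv _ _)).comp continuous_subtype_val
    simp only [Set.setOf_and]
    exact (isOpen_lt continuous_const ht).inter ((isOpen_lt ht continuous_const).inter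
      (isOpen_lt hr continuous_const))
  have hΦ₀at : ∀ y : slabW M a, ContMDiffAt 𝓘(ℝ, E4) (𝓡 4) ∞ Φ₀ (eN y) := fun y =>
    (hΦ.1 _ (hlayer y)).contMDiffAt (hLo.mem_nhds (hlayer y))
  have hΦ₀d : ∀ y : slabW M a, MDifferentiableAt 𝓘(ℝ, E4) (𝓡 4) Φ₀ (eN y) := fun y =>
    (hΦ₀at y).mdifferentiableAt (by simp)
  have hΦNd : ∀ y, MDifferentiableAt (𝓡 3) (𝓡 3) ΦN y := fun y => (hΦNs y).mdifferentiableAt (by simp)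
  -- order-`0` exactness at slab points
  have hiso : ∀ (y : slabW M a) (v' w' : E4), 𝒱.metric.val (Φ₀ (eN y)) (mfderiv 𝓘(ℝ, E4) (𝓡 4) Φ₀ (eN y) v')
      (mfderiv 𝓘(ℝ, E4) (𝓡 4) Φ₀ (eN y) w') = B.bilin (eN y).1 v' w' := fun y v' w' => by
    have h := congrArg (fun b => b v' w') (deviation_eq_zero_of_truncDeviationCk_le_zero₂ hdev (hslabmem y))
    simp only [Spacetime.deviation_apply, zero_apply, sub_eq_zero] at h
    exact h
  have hbilK : ∀ (y : slabW M a) (v' w' : E4), B.bilin (eN y).1 (Λ v') (Λ w') =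
      Kerr.bilin M a (E4.ofTimeSpace 0 (y : E3)) v' w' := fun y v' w' => by
    rw [hbil, boostedKerrBilin_apply, ← hPA]
    show Kerr.bilin M a (P (A (y : E3))) (Λ.symm (Λ v')) (Λ.symm (Λ w')) = _
    rw [ContinuousLinearEquiv.symm_apply_apply, ContinuousLinearEquiv.symm_apply_apply]
  -- chain rule: `d(ι ∘ Φ_N) = dΦ₀ ∘ Λ ∘ (v ↦ (0, v))`
  have hd : ∀ (y : slabW M a) (u : E3),
      mfderiv (𝓡 3) (𝓡 4) 𝒱.embed (ΦN y) (mfderiv (𝓡 3) (𝓡 3) ΦN y u) =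
        mfderiv 𝓘(ℝ, E4) (𝓡 4) Φ₀ (eN y) (Λ (E4.spaceEmbed u)) := by
    intro y u
    have hfun : 𝒱.embed ∘ ΦN = Φ₀ ∘ eN := funext hcomp
    have h1 : mfderiv 𝓘(ℝ, E3) (𝓡 4) (𝒱.embed ∘ ΦN) y =
        (mfderiv (𝓡 3) (𝓡 4) 𝒱.embed (ΦN y)).comp (mfderiv (𝓡 3) (𝓡 3) ΦN y) :=
      mfderiv_comp y (𝒱.mdifferentiable_embed _) (hΦNd y)
    have h2 : mfderiv 𝓘(ℝ, E3) (𝓡 4) (Φ₀ ∘ eN) y =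
        (mfderiv 𝓘(ℝ, E4) (𝓡 4) Φ₀ (eN y)).comp (mfderiv 𝓘(ℝ, E3) 𝓘(ℝ, E4) eN y) :=
      mfderiv_comp y (hΦ₀d y) (heNs.mdifferentiableAt (by simp))
    rw [hfun, h2, hdeN y] at h1
    exact (DFunLike.congr_fun h1 u).symm
  /- ## the Kerr normal representative and the normal identification (where (H8) enters) -/
  set NK : E3 → E4 := fun z => (√(1 + 2 * Kerr.scalarH M a (E4.ofTimeSpace 0 z)))⁻¹ •
    Kerr.timeVector M a (E4.ofTimeSpace 0 z) with hNK
  have hνNK : ∀ y : slabW M a, (νN M a y : E4) = NK (y : E3) := fun y => rfl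
  obtain ⟨⟨hKn, hKu⟩, hKf⟩ := Kerr.isFutureUnitNormal_sliceNormal_holds M a M hM.le
  have hKsp := Kerr.isSpacelikeImmersion_sliceEmbed_holds M a M hM.le
  have hnormal : ∀ y : slabW M a,
      mfderiv 𝓘(ℝ, E4) (𝓡 4) Φ₀ (eN y) (Λ (NK (y : E3))) = 𝒱.normal (ΦN y) := by
    intro y
    have hr0 : 0 < Kerr.radius a (E4.ofTimeSpace 0 (y : E3)) :=
      Kerr.radius_pos_of_mem_region (Kerr.mem_slice_iff_ofTimeSpace_mem_region.1 y.1.2)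
    refine TimeOrientation.eq_of_isFutureUnitNormal 𝒱.timeOrientation (q := 𝒱.embed (ΦN y))
      (q' := Φ₀ (eN y)) (hcomp y) (mfderiv 𝓘(ℝ, E3) (𝓡 4) (𝒱.embed ∘ ΦN) y) ?_ ?_ ?_ ?_ ?_ ?_ ?_ ?_
    · -- the image of `d(ι ∘ Φ_N)` is spacelike
      intro u hu
      have e : mfderiv 𝓘(ℝ, E3) (𝓡 4) (𝒱.embed ∘ ΦN) y u =
          mfderiv (𝓡 3) (𝓡 4) 𝒱.embed (ΦN y) (mfderiv (𝓡 3) (𝓡 3) ΦN y u) := by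
        rw [mfderiv_comp y (𝒱.mdifferentiable_embed _) (hΦNd y)]; rfl
      show 0 < 𝒱.metric.val (𝒱.embed (ΦN y)) (mfderiv 𝓘(ℝ, E3) (𝓡 4) (𝒱.embed ∘ ΦN) y u)
        (mfderiv 𝓘(ℝ, E3) (𝓡 4) (𝒱.embed ∘ ΦN) y u)
      rw [e, hd y u, hcomp y, hiso, hbilK]
      have h := hKsp.2 y.1 u hu
      rw [PseudoRiemannianMetric.inducedBilin_apply, Kerr.mfderiv_sliceEmbed] at h
      exact h
    · show Module.finrank ℝ E3 + 1 = Module.finrank ℝ E4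
      simp [finrank_euclideanSpace]
    · -- `ν ⊥ d(ι ∘ Φ_N)`
      intro u
      have e : mfderiv 𝓘(ℝ, E3) (𝓡 4) (𝒱.embed ∘ ΦN) y u =
          mfderiv (𝓡 3) (𝓡 4) 𝒱.embed (ΦN y) (mfderiv (𝓡 3) (𝓡 3) ΦN y u) := by
        rw [mfderiv_comp y (𝒱.mdifferentiable_embed _) (hΦNd y)]; rfl
      show 𝒱.metric.val (𝒱.embed (ΦN y)) (𝒱.normal (ΦN y))
        (mfderiv 𝓘(ℝ, E3) (𝓡 4) (𝒱.embed ∘ ΦN) y u) = 0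
      rw [e]
      exact 𝒱.isFutureUnitNormal.1.1 (ΦN y) _
    · exact 𝒱.isFutureUnitNormal.1.2 (ΦN y)
    · exact 𝒱.isFutureUnitNormal.2 (ΦN y)
    · -- `dΦ₀ (Λ N_K) ⊥ d(ι ∘ Φ_N)` (Kerr normal ⊥ slice, transported by the exact chart)
      intro u
      have e : mfderiv 𝓘(ℝ, E3) (𝓡 4) (𝒱.embed ∘ ΦN) y u =
          mfderiv (𝓡 3) (𝓡 4) 𝒱.embed (ΦN y) (mfderiv (𝓡 3) (𝓡 3) ΦN y u) := by
        rw [mfderiv_comp y (𝒱.mdifferentiable_embed _) (hΦNd y)]; rfl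
      show 𝒱.metric.val (Φ₀ (eN y)) (mfderiv 𝓘(ℝ, E4) (𝓡 4) Φ₀ (eN y) (Λ (NK (y : E3))))
        (mfderiv 𝓘(ℝ, E3) (𝓡 4) (𝒱.embed ∘ ΦN) y u) = 0
      rw [e, hd y u, hiso, hbilK]
      have h := hKn y.1 u
      rw [Kerr.mfderiv_sliceEmbed] at h
      exact h
    · -- unit
      rw [hiso, hbilK]
      exact hKu y.1
    · -- future-directed: (H8) and positivity of the lapse factor
      have hpos : 0 < (√(1 + 2 * Kerr.scalarH M a (E4.ofTimeSpace 0 (y : E3))))⁻¹ := by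
        have : 0 < 1 + 2 * Kerr.scalarH M a (E4.ofTimeSpace 0 (y : E3)) := by
          linarith [Kerr.scalarH_nonneg hM.le a (E4.ofTimeSpace 0 (y : E3))]
        exact inv_pos.2 (Real.sqrt_pos.2 this)
      have hH8 := hor (eN y) (hslabmem y)
      rw [show P (eN y).1 = E4.ofTimeSpace 0 (y : E3) from hPA _] at hH8
      have e : Λ (NK (y : E3)) = (√(1 + 2 * Kerr.scalarH M a (E4.ofTimeSpace 0 (y : E3))))⁻¹ •
          Λ (Kerr.timeVector M a (E4.ofTimeSpace 0 (y : E3))) := by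
        simp only [hNK, map_smul]
      rw [e]
      convert hH8.smul hpos using 1
      exact (mfderiv 𝓘(ℝ, E4) (𝓡 4) Φ₀ (eN y)).map_smul _ _
  /- ## the abstract hypotheses of the development-side chart lemma -/
  have hbs : ∀ x : B.domain, x ∈ {x : B.domain | -1 < B.time x.1 ∧ B.time x.1 < 1 ∧
      B.radius x.1 < 3 * M + 1} → ContDiffAt ℝ ∞ B.bilin (x : E4) := fun x _ => by
    have hr : 0 < Kerr.radius a (poincareInv mo.1 mo.2 (x : E4)) :=
      Kerr.radius_pos_of_mem_region (hPreg x)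
    rw [hbil]; exact contDiffAt_boostedKerrBilin _ _ _ _ hr
  have hdev0 : ∀ y : slabW M a, 𝒱.toSpacetime.deviation B Φ₀ (eN y) = 0 := fun y =>
    deviation_eq_zero_of_truncDeviationCk_le_zero₂ hdev (hslabmem y)
  have hdev1 : ∀ y : slabW M a,
      iteratedFDeriv ℝ 1 (𝒱.toSpacetime.deviationExtend B Φ₀) (eN y : E4) = 0 := fun y => by
    have hle := (enorm_iteratedFDeriv_le_supCkENorm (k := k') (m := 1) hk'
      (mem_image_of_mem Subtype.val (hslabmem y)) (𝒱.toSpacetime.deviationExtend B Φ₀)).trans hdev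
    have := le_antisymm hle zero_le
    rwa [enorm_eq_zero] at this
  have hB0inj : ∀ y : slabW M a, Injective (B.bilin (eN y : E4) : E4 →L[ℝ] E4 →L[ℝ] ℝ) := by
    intro y u₁ u₂ h
    have key : ∀ w' : E4, Kerr.bilin M a (E4.ofTimeSpace 0 (y : E3)) (Λ.symm (u₁ - u₂)) w' = 0 := by
      intro w'
      have e := congrArg (fun T : E4 →L[ℝ] ℝ => T (Λ w')) h
      rw [← hbilK, ContinuousLinearEquiv.apply_symm_apply, map_sub, sub_apply, sub_eq_zero]
      exact e
    have hr0 : 0 < Kerr.radius a (E4.ofTimeSpace 0 (y : E3)) :=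
      Kerr.radius_pos_of_mem_region (Kerr.mem_slice_iff_ofTimeSpace_mem_region.1 y.1.2)
    have h0 := Kerr.bilin_nondegenerate M a hr0 _ key
    have : u₁ - u₂ = 0 := by simpa using congrArg Λ h0
    exact sub_eq_zero.1 this
  have hNKd : ∀ y : slabW M a, DifferentiableAt ℝ (fun z => Λ (NK z)) (y : E3) := fun y => by
    have hr0 : 0 < Kerr.radius a (E4.ofTimeSpace 0 (y : E3)) :=
      Kerr.radius_pos_of_mem_region (Kerr.mem_slice_iff_ofTimeSpace_mem_region.1 y.1.2)
    exact ((Λ : E4 →L[ℝ] E4).differentiableAt).comp _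
      ((Kerr.contDiffAt_sliceNormalRep hM.le a hr0 (n := 1)).differentiableAt one_ne_zero)
  /- ## both sides equal the same chart expression -/
  have hL := collar_secondFundamentalForm_chart 𝒱 mo B Φ₀ ΦN
    {x : B.domain | -1 < B.time x.1 ∧ B.time x.1 < 1 ∧ B.radius x.1 < 3 * M + 1} hLo hΦ.1 hbs eN
    (fun _ => rfl) hlayer hΦNs hcomp hdev0 hdev1 hB0inj (fun z => Λ (NK z)) hNKd hnormal y v w
  have hR := kerrSlab_secondFundamentalForm_chart M a mo B hM hB y v w
  exact hL.trans hR.symm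

end F1Route

open F1Route in
/-- **Registered bookkeeping sub-goal `stub_slabSecondFormIdentity` of the line** (brick of the landing
of F1' `stub_slabCauchyRigidity'`): (A2k) — for a future-oriented exact collar chart (exact `k'`-jet
on the thick slab, `k' ≥ 1`) of a vacuum development and any smooth `Φ_N` through which it factors on
the open slab, `Φ_N^* k = K_{ν_N}(ψ_N)`, the Kerr slab second fundamental form.
[cite: ONeill1983, Ch. 4, Cor. 4.5] -/
theorem stub_slabSecondFormIdentity :
    ∀ [Kerr.Facts] [Kerr.SliceFacts] (k' : ℕ), 1 ≤ k' →
    ∀ (X : Type) [TopologicalSpace X] [ChartedSpace E3 X] [IsManifold (𝓡 3) ∞ X]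
      [T2Space X] [SecondCountableTopology X] [ConnectedSpace X]
      (D : InitialDataSet (𝓡 3) X) (𝒱 : VacuumCauchyDevelopment D)
      (M a : ℝ) (mo : lorentzGroup × E4) (B : ModelBackground) (Φ₀ : B.domain → 𝒱.carrier)
      (ΦN : F1Route.slabW M a → X), 0 < M → |a| < M →
    B = starBackground mo.1 mo.2 M a (fun x => Kerr.radius a (poincareInv mo.1 mo.2 x)) →
    (ContMDiffOn 𝓘(ℝ, E4) (𝓡 4) ∞ Φ₀
        {x | -1 < B.time x.1 ∧ B.time x.1 < 1 ∧ B.radius x.1 < 3 * M + 1} ∧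
      IsOpenEmbedding ({x | -1 < B.time x.1 ∧ B.time x.1 < 1 ∧
        B.radius x.1 < 3 * M + 1}.restrict Φ₀)) →
    𝒱.toSpacetime.truncDeviationCk B Φ₀ k' (3 * M) 0 ≤ 0 →
    Φ₀ '' B.truncTimeSlab (3 * M) 0 ⊆ range 𝒱.embed →
    (∀ x ∈ B.truncTimeSlab (3 * M) 0, 𝒱.timeOrientation.IsFutureDirected
      (mfderiv 𝓘(ℝ, E4) (𝓡 4) Φ₀ x
        ((mo.1 : E4 ≃L[ℝ] E4) (Kerr.timeVector M a (poincareInv mo.1 mo.2 x.1))))) →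
    ContMDiff (𝓡 3) (𝓡 3) ((((⊤ : ℕ∞) : WithTop ℕ∞)) + 1) ΦN →
    (∀ y : F1Route.slabW M a,
      ∃ hx : ((mo.1 : E4 ≃L[ℝ] E4) (E4.ofTimeSpace 0 (y : E3)) + mo.2) ∈ B.domain,
        𝒱.embed (ΦN y) = Φ₀ ⟨_, hx⟩) →
    ∀ [(Kerr.smoothMetric M a M).HasLeviCivita] (y : F1Route.slabW M a) (v w : E3),
      D.k (ΦN y) (mfderiv (𝓡 3) (𝓡 3) ΦN y v) (mfderiv (𝓡 3) (𝓡 3) ΦN y w) =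
        (Kerr.smoothMetric M a M).secondFundamentalForm 𝓘(ℝ, E3) (F1Route.ψN M a) (F1Route.νN M a)
          y v w :=
  slabSecondFormIdentity_holds

end Summit.FinalStateConjecture.FinalStateConjecture.Theorems.BondiBartnikRigidity.DirectMethod

end
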